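import Mathlib
import Literature.Computability.AlgebraicComplexity.BigCwOmegaBound

/-!
# Packing count at `q = 6`, `β = 1/19` — stub `stub_packingCount` of line `digit-sum-sliced-laser`
(crux `AutomaticDesignBelowFourFifths`, stmt-MatrixMultiplication-7357, route `AutomaticSTPPDesigns`)

The line builds an STPP family in the cyclic group `ℤ/8^N`, `N = 3a + 3b`, with `p = |Δ|` blocks of
size `S × S × S`, where `Δ` is the Coppersmith–Winograd level-1 free diagonal for `CW_6` (size clause
`binom(N; a+2b, 2a, b) · roth(3f) ≤ 288 f p`, the conclusion of the tree's
`exists_free_bigCw_diagonal`) and `S` is a constant-digit-sum slice of `[0,6)^a` with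
`6^a ≤ (5a+1) S` (pigeonhole).  This file proves the numerical step: at `a = 18c`, `b = c`
(`β = 1/19`, `N = 57c`) and `c ≥ 10^6` the packing sum `p · (S³)^{4/5}` exceeds the host order `8^N`.

In logarithms (tree `log_laserDiagonal_lower`: `log p ≥ N·H(20/57, 12/19, 1/57) − 20√N − log 96`;
slice: `log S ≥ 18c·log 6 − log(90c+1)`) the claim is
`57c · 3 log 2 < log p + (12/5) log S`; per unit of `c` the main terms give
`57H + (12/5)·18 log 6 − 57 log 8 = −239.8 log 2 + 28.2 log 3 − 20 log 5 + 57 log 19 ≥ 0.40488`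
with the tree's one-sided constants (`Real.log_two_lt_d9`, `log_three_gt`, `log_five_lt`,
`log_nineteen_gt`), while the losses are `20√(57c) ≤ 0.0755c + 75500`,
`(12/5) log(90c+1) ≤ 0.0216c + 24002.4` (`log x ≤ 2√x`) and `log 96 ≤ 95`; the margin at `c = 10^6`
is about `2·10^5` nats.  This is Coppersmith–Winograd 1990 §7 (`ω ≤ 3τ < 2.38719 < 2.4` at `q = 6`)
read at exponent `4/5`.
-/

-- single-conjunct summit: the mandated namespace repeats `MatrixMultiplication`.
set_option linter.dupNamespace false

noncomputable section

open Finset Real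
open scoped BigOperators
open Literature.Computability.AlgebraicComplexity

namespace Summit.MatrixMultiplication.MatrixMultiplication.Theorems

namespace AutomaticDesignBelowFourFifths

/-- The entropy term of `log_laserDiagonal_lower` at `a = 18c`, `b = c`:
`N · H(20/57, 12/19, 1/57) = c · (−112 log 2 − 15 log 3 − 20 log 5 + 57 log 19)` (`N = 57c`).
[cite: CoppersmithWinograd1990, §7] -/
theorem packingCount_entropy {a b c : ℕ} (ha : a = 18 * c) (hb : b = c) (hc : 0 < c) :
    ((3 * a + 3 * b : ℕ) : ℝ) *
        (∑ i, negMulLog (((![a + 2 * b, 2 * a, b] : Fin 3 → ℕ) i : ℝ) /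
          ((3 * a + 3 * b : ℕ) : ℝ))) =
      (c : ℝ) * (-112 * Real.log 2 - 15 * Real.log 3 - 20 * Real.log 5 + 57 * Real.log 19) := by
  have hx0 : (0 : ℝ) < (c : ℝ) := by exact_mod_cast hc
  have hN : ((3 * a + 3 * b : ℕ) : ℝ) = 57 * (c : ℝ) := by rw [ha, hb]; push_cast; ring
  rw [Fin.sum_univ_three]
  simp only [Matrix.cons_val_zero, Matrix.cons_val_one, Matrix.cons_val_two, Matrix.head_cons,
    Matrix.tail_cons]
  rw [hN]
  have r0 : ((a + 2 * b : ℕ) : ℝ) / (57 * (c : ℝ)) = 2 ^ 2 * 5 / (3 * 19) := by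
    rw [div_eq_div_iff (by positivity) (by norm_num), ha, hb]; push_cast; ring
  have r1 : ((2 * a : ℕ) : ℝ) / (57 * (c : ℝ)) = 2 ^ 2 * 3 / 19 := by
    rw [div_eq_div_iff (by positivity) (by norm_num), ha]; push_cast; ring
  have r2 : ((b : ℕ) : ℝ) / (57 * (c : ℝ)) = 1 / (3 * 19) := by
    rw [div_eq_div_iff (by positivity) (by norm_num), hb]; ring
  rw [r0, r1, r2]
  have e0 : negMulLog ((2 : ℝ) ^ 2 * 5 / (3 * 19)) =
      -(2 ^ 2 * 5 / (3 * 19)) * (2 * Real.log 2 + Real.log 5 - (Real.log 3 + Real.log 19)) := by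
    rw [negMulLog, Real.log_div (by norm_num) (by norm_num), Real.log_mul (by norm_num) (by norm_num),
      Real.log_mul (by norm_num) (by norm_num), Real.log_pow]
    push_cast; ring
  have e1 : negMulLog ((2 : ℝ) ^ 2 * 3 / 19) =
      -(2 ^ 2 * 3 / 19) * (2 * Real.log 2 + Real.log 3 - Real.log 19) := by
    rw [negMulLog, Real.log_div (by norm_num) (by norm_num), Real.log_mul (by norm_num) (by norm_num),
      Real.log_pow]
    push_cast; ring
  have e2 : negMulLog ((1 : ℝ) / (3 * 19)) = -(1 / (3 * 19)) * (-(Real.log 3 + Real.log 19)) := by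
    rw [negMulLog, Real.log_div (by norm_num) (by norm_num), Real.log_one,
      Real.log_mul (by norm_num) (by norm_num)]
    ring
  rw [e0, e1, e2]
  ring

/-- `20 √(57x) ≤ 0.0755 x + 75500` for `x ≥ 0` (AM–GM at `√(57x) = 7550`, i.e. `x ≈ 10^6`).
[folklore] -/
theorem packingCount_sqrt_le (x : ℝ) (hx : 0 ≤ x) : 20 * √(57 * x) ≤ 0.0755 * x + 75500 := by
  have h1 : 0 ≤ √(57 * x) := Real.sqrt_nonneg _
  have h2 : √(57 * x) ^ 2 = 57 * x := Real.sq_sqrt (by positivity)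
  nlinarith [sq_nonneg (√(57 * x) - 7550)]

/-- `log(90x + 1) ≤ 0.009 x + 10001` for `x ≥ 0` (`log y ≤ 2√y` and AM–GM at `√y = 10^4`).
[folklore] -/
theorem packingCount_log_le (x : ℝ) (hx : 0 ≤ x) : Real.log (90 * x + 1) ≤ 0.009 * x + 10001 := by
  have h0 : (0 : ℝ) < 90 * x + 1 := by positivity
  have h1 := log_le_two_mul_sqrt h0
  have h2 : 0 ≤ √(90 * x + 1) := Real.sqrt_nonneg _
  have h3 : √(90 * x + 1) ^ 2 = 90 * x + 1 := Real.sq_sqrt h0.le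
  nlinarith [sq_nonneg (√(90 * x + 1) - 10000)]

/-- **Packing count** (registered stub `stub_packingCount` of line `digit-sum-sliced-laser`;
numerics of Coppersmith–Winograd 1990 §7 at exponent `4/5`): with `a = 18c`, `b = c`, `c ≥ 10^6`,
the size clause of the free diagonal (`log p ≥ N·H(20/57, 12/19, 1/57) − 20√N − log 96`,
tree `log_laserDiagonal_lower`) and the slice bound `6^a ≤ (5a+1) S` give
`8^{3a+3b} < p · (S³)^{4/5}`: per unit of `c`,
`57H + (12/5)·18 log 6 − 57 log 8 ≥ 0.40488 > 0.0971 + 10^{-6}·99598` (losses `20√(57c)`,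
`(12/5) log(90c+1)`, `log 96`). [cite: CoppersmithWinograd1990, §7] -/
theorem stub_packingCount :
    ∀ (a b c p S : ℕ), a = 18 * c → b = c → 1000000 ≤ c →
      Nat.multinomial univ ![a + 2 * b, 2 * a, b] *
          rothNumberNat (3 * ((2 * a).choose a * ((a + 2 * b).choose a * (2 * b).choose b))) ≤
        288 * ((2 * a).choose a * ((a + 2 * b).choose a * (2 * b).choose b)) * p →
      6 ^ a ≤ (5 * a + 1) * S →
      ((8 ^ (3 * a + 3 * b) : ℕ) : ℝ) < (p : ℝ) * (((S * S * S : ℕ) : ℝ)) ^ ((4 : ℝ) / 5) := by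
  intro a b c p S ha hb hc hsize hS
  -- the real parameter `c ≥ 10^6`
  have hx : (1000000 : ℝ) ≤ (c : ℝ) := by exact_mod_cast hc
  have hx0 : (0 : ℝ) < (c : ℝ) := by linarith
  have ha' : (a : ℝ) = 18 * (c : ℝ) := by rw [ha]; push_cast; ring
  have hN : ((3 * a + 3 * b : ℕ) : ℝ) = 57 * (c : ℝ) := by rw [ha, hb]; push_cast; ring
  -- (1) the diagonal is large: `c·(57H) − 20√(57c) − log 96 ≤ log p`
  obtain ⟨hp0, hlogp⟩ := log_laserDiagonal_lower (p := p) (by omega : 1 ≤ a) hsize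
  rw [packingCount_entropy ha hb (by omega), hN] at hlogp
  -- (2) the slice is large: `18c·log 6 ≤ log(90c+1) + log S`
  have hS1 : 0 < S := by
    rcases Nat.eq_zero_or_pos S with h | h
    · rw [h, mul_zero] at hS
      exact absurd hS (not_le.2 (by positivity))
    · exact h
  have hSr : (0 : ℝ) < (S : ℝ) := by exact_mod_cast hS1
  have hS' : (6 : ℝ) ^ a ≤ ((5 * a + 1 : ℕ) : ℝ) * (S : ℝ) := by exact_mod_cast hS
  have hlogS : 18 * (c : ℝ) * (Real.log 2 + Real.log 3) ≤
      Real.log (90 * (c : ℝ) + 1) + Real.log S := by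
    have h := Real.log_le_log (by positivity) hS'
    rw [Real.log_pow, Real.log_mul (by positivity) hSr.ne', ha'] at h
    have h5a : ((5 * a + 1 : ℕ) : ℝ) = 90 * (c : ℝ) + 1 := by push_cast; rw [ha']; ring
    have e6 : Real.log 6 = Real.log 2 + Real.log 3 := by
      rw [show (6 : ℝ) = 2 * 3 by norm_num, Real.log_mul (by norm_num) (by norm_num)]
    rw [h5a, e6] at h
    linarith
  -- (3) the goal in logarithmic form: `57c · 3 log 2 < log p + (4/5) · 3 log S`
  have h8 : (0 : ℝ) < ((8 ^ (3 * a + 3 * b) : ℕ) : ℝ) := by positivity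
  have hSSS : (0 : ℝ) < ((S * S * S : ℕ) : ℝ) := by
    push_cast; exact mul_pos (mul_pos hSr hSr) hSr
  have hpow : (0 : ℝ) < (((S * S * S : ℕ) : ℝ)) ^ ((4 : ℝ) / 5) := Real.rpow_pos_of_pos hSSS _
  rw [← Real.log_lt_log_iff h8 (mul_pos hp0 hpow), Real.log_mul hp0.ne' hpow.ne',
    Real.log_rpow hSSS]
  have e8 : Real.log ((8 : ℕ) : ℝ) = 3 * Real.log 2 := by
    rw [show ((8 : ℕ) : ℝ) = 2 ^ 3 by norm_num, Real.log_pow]; push_cast; ring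
  have e8N : Real.log (((8 ^ (3 * a + 3 * b) : ℕ) : ℝ)) = 57 * (c : ℝ) * (3 * Real.log 2) := by
    rw [Nat.cast_pow, Real.log_pow, hN, e8]
  have eS3 : Real.log (((S * S * S : ℕ) : ℝ)) = 3 * Real.log S := by
    push_cast
    rw [Real.log_mul (mul_pos hSr hSr).ne' hSr.ne', Real.log_mul hSr.ne' hSr.ne']; ring
  rw [e8N, eS3]
  -- (4) numerics with the one-sided constants of the tree
  have hL2 := Real.log_two_lt_d9
  have hL3 := log_three_gt
  have hL5 := log_five_lt
  have hL19 := log_nineteen_gt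
  have p2 : (c : ℝ) * Real.log 2 ≤ (c : ℝ) * 0.6931471808 := mul_le_mul_of_nonneg_left hL2.le hx0.le
  have p3 : (c : ℝ) * 1.09852 ≤ (c : ℝ) * Real.log 3 := mul_le_mul_of_nonneg_left hL3.le hx0.le
  have p5 : (c : ℝ) * Real.log 5 ≤ (c : ℝ) * 1.60946 := mul_le_mul_of_nonneg_left hL5.le hx0.le
  have p19 : (c : ℝ) * 2.94443 ≤ (c : ℝ) * Real.log 19 := mul_le_mul_of_nonneg_left hL19.le hx0.le
  have hsb := packingCount_sqrt_le (c : ℝ) hx0.le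
  have hlb := packingCount_log_le (c : ℝ) hx0.le
  have h96 : Real.log 96 ≤ 96 - 1 := Real.log_le_sub_one_of_pos (by norm_num)
  linarith

end AutomaticDesignBelowFourFifths

end Summit.MatrixMultiplication.MatrixMultiplication.Theorems

end
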